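import Summits.AtomisticToContinuum.FouriersLaw.Theses.PhononMeanFreePath
import Literature.Barriers.AtomisticToContinuum.LowTemperatureWeakAnharmonicity

/-!
# CoherentDephasing — amplitude-scaling conjugacy of the constructed kernels and the
unit-temperature normal form (negative-side support)

Support lemmas for crux `PhononMeanFreePath.CoherentDephasing` (item stmt-AtomisticToContinuum-11810)
from the standing disprover's work file `Cruxes/CoherentDephasing/Disproof.lean` §8, all
sorry-free. The amplitude scaling `(q, p) ↦ (s q, s p)` conjugates the equal-temperature Langevin
chain `pinnedChain ω₂ lam β γ` at temperature `T` with `pinnedChain ω₂ (lam s²) (β s²) γ` at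
temperature `T / s²` — so far proved in the tree only at the level of the generator and of weak
steady states (`Literature.Barriers.AtomisticToContinuum.LowTemperatureWeakAnharmonicity`:
`hamiltonian_smul`, `generator_smul`, `isSteadyState_map_smul`). Here it is proved for the
CONSTRUCTED objects the crux is typed with:

* `drift_smul`, `chainNoise_smul`, `chainFlow_smul` (pathwise: the rescaled flow solves the
  rescaled Langevin integral equation; uniqueness `pinnedChain_eqOn_chainFlow`), `solMap_smul`;
* `integral_snd_transitionKernel_smul`: `(K_t p_i)(s • x) = s · (K'_t p_i)(x)` for the transition
  kernels (law of the pathwise flow under the Brownian pair);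
* `gibbsDensity_smul`, `integral_gibbsMeasure_smul`: `E_{μ_T}[g] = E_{μ'_{T/s²}}[g ∘ (s • ·)]`
  (tilted Lebesgue measure + `Measure.integral_comp_smul`);
* `pairCorr_smul`, `pairCorr_eq_temp_mul_unit`: the crux's two-point function obeys
  `r_N(t; lam, β, T) = T · r_N(t; lam T, β T, 1)` (the `ScalingCovariance` first lemma of the
  crux idea cards `scaling-ward-monotone-transfer` / `heating-never-recoheres`, now a theorem);
* `coherentDephasing_iff_unit_temperature`: **normal form — the crux is its `T = 1` slice over all
  couplings**; the quantifier `∀ T > 0` is redundant given `∀ lam, β > 0`, the temperature axis IS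
  the coupling ray `(lam T, β T)`, and every `T`-uniform or `T`-monotone strengthening is a
  statement along coupling rays (what a disproof may assume; what a prover may fix).
* rev 2: `coherentDephasingWeakCoupling_iff_corner` (support item stmt-11813 = the small-coupling
  CORNER `a, b ≤ ε₀` of the normal form: the route's regime split is a split of the coupling quadrant
  at `T = 1`), `harmonicCoherentPersistence_iff_unit` (calibration item stmt-11814 reduces to
  `T = 1`).
-/

noncomputable section

open MeasureTheory Filter Topology Set
open scoped NNReal
open Literature.MathematicalPhysics.KineticTheory.HeatConduction
open Literature.Barriers.AtomisticToContinuum.HeatConduction (hamiltonian_smul partialQ_hamiltonian_scaled)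
open Literature.Probability.Process

namespace Summit.AtomisticToContinuum.FouriersLaw.Theorems.CoherentDephasing.Negative.ScalingNormalForm


variable {ω₂ lam β γ : ℝ}

/-- Drift scaling: `Y_{lam,β}(s • y) = s • Y_{lam s², β s²}(y)` (the force of the pinned chain is
odd-homogeneous of degrees 1 and 3, the friction linear). [folklore] -/
theorem drift_smul {s : ℝ} (hs : s ≠ 0) (n : ℕ) (y : PhaseSpace n) :
    (pinnedChain ω₂ lam β γ).drift n (s • y) =
      s • (pinnedChain ω₂ (lam * s ^ 2) (β * s ^ 2) γ).drift n y := by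
  refine Prod.ext ?_ (funext fun i => ?_)
  · simp [OscillatorChain.drift]
  · simp only [OscillatorChain.drift, Prod.smul_snd, Pi.smul_apply, smul_eq_mul]
    have h := partialQ_hamiltonian_scaled ω₂ lam β γ hs i y (N := n)
    have h' : partialQ i ((pinnedChain ω₂ lam β γ).hamiltonian n) (s • y) =
        s * partialQ i ((pinnedChain ω₂ (lam * s ^ 2) (β * s ^ 2) γ).hamiltonian n) y := by
      rw [h]; field_simp
    rw [h']
    simp only [pinnedChain]
    ring

/-- Noise scaling: the momentum-noise path is linear in the amplitudes. [folklore] -/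
theorem chainNoise_smul (s : ℝ) (n : ℕ) (cL cR : ℝ) (w : WienerPair) :
    chainNoise n (s * cL) (s * cR) w = s • chainNoise n cL cR w := by
  funext t i
  simp only [chainNoise, Pi.smul_apply, smul_eq_mul]
  split_ifs <;> ring

/-- **Pathwise amplitude scaling of the flow**: `Φ^{lam,β}_t(s • x, s • η) = s • Φ^{lam s²,β s²}_t(x, η)`
(the right-hand side solves the rescaled Langevin integral equation; uniqueness of (IE)).
[folklore] -/
theorem chainFlow_smul (hω : 0 < ω₂) (hl : 0 ≤ lam) (hβ : 0 ≤ β) (hγ : 0 ≤ γ) {s : ℝ} (hs : s ≠ 0)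
    (n : ℕ) (x : PhaseSpace n) {η : ℝ → Fin n → ℝ} (hη : Continuous η) (t : ℝ) :
    (pinnedChain ω₂ lam β γ).chainFlow n (s • x) (s • η) t =
      s • (pinnedChain ω₂ (lam * s ^ 2) (β * s ^ 2) γ).chainFlow n x η t := by
  have hsη : Continuous (s • η) := hη.const_smul s
  rcases le_or_gt t 0 with ht | ht
  · rw [pinnedChain_chainFlow_of_nonpos ω₂ lam β γ n (s • x) hsη ht,
      pinnedChain_chainFlow_of_nonpos ω₂ _ _ γ n x hη ht]
    ext i <;> simp
  · have hl' : 0 ≤ lam * s ^ 2 := by positivity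
    have hβ' : 0 ≤ β * s ^ 2 := by positivity
    set P := pinnedChain ω₂ lam β γ with hP
    set P' := pinnedChain ω₂ (lam * s ^ 2) (β * s ^ 2) γ with hP'
    set z : ℝ → PhaseSpace n := fun u => s • P'.chainFlow n x η u with hz
    have hzc : Continuous z :=
      (pinnedChain_continuous_chainFlow hω hl' hβ' hγ n x hη).const_smul s
    have hsol' := pinnedChain_isIntegralSolutionOn_chainFlow hω hl' hβ' hγ n x hη t
    have hsol : Literature.Analysis.ODE.IsIntegralSolutionOn (P.drift n)
        (OscillatorChain.forcing (s • x) (s • η)) z t := by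
      intro u hu
      have h1 := hsol' u hu
      simp only [hz]
      rw [h1, smul_add]
      congr 1
      · simp [OscillatorChain.forcing, smul_add]
      · rw [← intervalIntegral.integral_smul]
        refine intervalIntegral.integral_congr fun r _ => ?_
        simp only [hP]
        rw [drift_smul hs]
    have key := pinnedChain_eqOn_chainFlow hω hl hβ hγ n (s • x) hsη hsol hzc ⟨ht.le, le_rfl⟩
    simpa [hz] using key.symm

/-- Solution-map scaling: noise amplitudes `√(2γT) = s √(2γT/s²)`, so temperatures are divided by
`s²` while the quartic couplings are multiplied by `s²`. [folklore] -/
theorem solMap_smul (hω : 0 < ω₂) (hl : 0 ≤ lam) (hβ : 0 ≤ β) (hγ : 0 ≤ γ) {s : ℝ} (hs : 0 < s)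
    (n : ℕ) (T t : ℝ) (x : PhaseSpace n) (w : WienerPair) :
    (pinnedChain ω₂ lam β γ).solMap n T T t (s • x) w =
      s • (pinnedChain ω₂ (lam * s ^ 2) (β * s ^ 2) γ).solMap n (T / s ^ 2) (T / s ^ 2) t x w := by
  unfold OscillatorChain.solMap
  have hγP : (pinnedChain ω₂ lam β γ).γ = γ := rfl
  have hγP' : (pinnedChain ω₂ (lam * s ^ 2) (β * s ^ 2) γ).γ = γ := rfl
  have hsq : Real.sqrt (2 * γ * T) = s * Real.sqrt (2 * γ * (T / s ^ 2)) := by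
    rw [show 2 * γ * T = s ^ 2 * (2 * γ * (T / s ^ 2)) by field_simp]
    rw [Real.sqrt_mul (sq_nonneg s), Real.sqrt_sq hs.le]
  rw [hγP, hγP', hsq, chainNoise_smul]
  exact chainFlow_smul hω hl hβ hγ hs.ne' n x (continuous_chainNoise _ _ w) t

/-- **Kernel scaling** for the momentum coordinates of the constructed transition kernels:
`(K^{lam,β;T}_t p_i)(s • x) = s · (K^{lam s²,β s²;T/s²}_t p_i)(x)`. [folklore] -/
theorem integral_snd_transitionKernel_smul (hω : 0 < ω₂) (hl : 0 ≤ lam) (hβ : 0 ≤ β) (hγ : 0 ≤ γ)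
    {s : ℝ} (hs : 0 < s) (n : ℕ) (T : ℝ) (t : ℝ≥0) (x : PhaseSpace n) (i : Fin n) :
    ∫ y, y.2 i ∂((pinnedChain ω₂ lam β γ).transitionKernel n T T t (s • x)) =
      s * ∫ y, y.2 i ∂((pinnedChain ω₂ (lam * s ^ 2) (β * s ^ 2) γ).transitionKernel n
        (T / s ^ 2) (T / s ^ 2) t x) := by
  have hl' : 0 ≤ lam * s ^ 2 := by positivity
  have hβ' : 0 ≤ β * s ^ 2 := by positivity
  have hg : Continuous fun y : PhaseSpace n => y.2 i := (continuous_apply i).comp continuous_snd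
  rw [pinnedChain_integral_transitionKernel hω hl hβ hγ n T T t (s • x) hg.aestronglyMeasurable,
    pinnedChain_integral_transitionKernel hω hl' hβ' hγ n _ _ t x hg.aestronglyMeasurable,
    ← integral_const_mul]
  refine integral_congr_ae (Eventually.of_forall fun w => ?_)
  simp only
  rw [solMap_smul hω hl hβ hγ hs]
  simp

/-- Lebesgue measure on phase space (a product of two copies of `ℝ^n`) is an additive Haar measure
(instance assembled by hand: typeclass search does not find the product instance). [folklore] -/
theorem isAddHaarMeasure_volume_phaseSpace (n : ℕ) :
    Measure.IsAddHaarMeasure (volume : Measure (PhaseSpace n)) :=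
  @Measure.prod.instIsAddHaarMeasure (Fin n → ℝ) _ _ _ (Fin n → ℝ) _ _ _ volume volume _ _ _ _ _ _

/-- Gibbs densities under the scaling: `ρ^{lam s²,β s²}_{T/s²}(x) = ρ^{lam,β}_T(s • x)`
(`H_{lam,β}(s • x) = s² H_{lam s²,β s²}(x)`). [folklore] -/
theorem gibbsDensity_smul (s : ℝ) (n : ℕ) (T : ℝ) (x : PhaseSpace n) :
    (pinnedChain ω₂ (lam * s ^ 2) (β * s ^ 2) γ).gibbsDensity n (T / s ^ 2) x =
      (pinnedChain ω₂ lam β γ).gibbsDensity n T (s • x) := by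
  simp only [OscillatorChain.gibbsDensity, hamiltonian_smul]
  congr 1
  rw [div_div_eq_mul_div]
  ring

/-- **Gibbs expectations under the scaling**: `E_{μ^{lam,β}_T}[g] = E_{μ^{lam s²,β s²}_{T/s²}}[g ∘ (s • ·)]`
for every `g` and `s ≠ 0` (both sides are ratios of Lebesgue integrals; change of variables
`Measure.integral_comp_smul`; junk values agree). [folklore] -/
theorem integral_gibbsMeasure_smul {s : ℝ} (hs : s ≠ 0) (n : ℕ) (T : ℝ) (g : PhaseSpace n → ℝ) :
    ∫ x, g x ∂((pinnedChain ω₂ lam β γ).gibbsMeasure n T) =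
      ∫ x, g (s • x) ∂((pinnedChain ω₂ (lam * s ^ 2) (β * s ^ 2) γ).gibbsMeasure n (T / s ^ 2)) := by
  haveI := isAddHaarMeasure_volume_phaseSpace n
  set P := pinnedChain ω₂ lam β γ with hP
  set P' := pinnedChain ω₂ (lam * s ^ 2) (β * s ^ 2) γ with hP'
  set c : ℝ := |(s ^ Module.finrank ℝ (PhaseSpace n))⁻¹| with hc
  have hc0 : c ≠ 0 := by
    simp only [hc, ne_eq, abs_eq_zero, inv_eq_zero]
    exact pow_ne_zero _ hs
  have hρ : ∀ x, P'.gibbsDensity n (T / s ^ 2) x = P.gibbsDensity n T (s • x) :=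
    fun x => gibbsDensity_smul s n T x
  have h1 : ∫ x, g (s • x) * P'.gibbsDensity n (T / s ^ 2) x =
      c * ∫ y, g y * P.gibbsDensity n T y := by
    have := Measure.integral_comp_smul volume (fun y => g y * P.gibbsDensity n T y) s
    simp only [smul_eq_mul] at this
    simp only [hρ]
    exact this
  have h2 : ∫ x, P'.gibbsDensity n (T / s ^ 2) x = c * ∫ y, P.gibbsDensity n T y := by
    have := Measure.integral_comp_smul volume (fun y => P.gibbsDensity n T y) s
    simp only [smul_eq_mul] at this
    simp only [hρ]
    exact this
  rw [P.integral_gibbsMeasure, P'.integral_gibbsMeasure, h1, h2, mul_inv, mul_mul_mul_comm,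
    inv_mul_cancel₀ hc0, one_mul]

/-- **Amplitude scaling of the crux's pair correlation**: for `s > 0`,
`r_N(t; lam, β, T) = s² · r_N(t; lam s², β s², T/s²)`. [folklore] -/
theorem pairCorr_smul (hω : 0 < ω₂) (hl : 0 ≤ lam) (hβ : 0 ≤ β) (hγ : 0 ≤ γ) {s : ℝ} (hs : 0 < s)
    (N : ℕ) (T t : ℝ) :
    (∫ z, z.2 0 * (∫ y, y.2 (Fin.last N)
      ∂((pinnedChain ω₂ lam β γ).transitionKernel (N + 1) T T t.toNNReal z))
      ∂((pinnedChain ω₂ lam β γ).gibbsMeasure (N + 1) T)) =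
    s ^ 2 * ∫ z, z.2 0 * (∫ y, y.2 (Fin.last N)
      ∂((pinnedChain ω₂ (lam * s ^ 2) (β * s ^ 2) γ).transitionKernel (N + 1) (T / s ^ 2) (T / s ^ 2)
        t.toNNReal z))
      ∂((pinnedChain ω₂ (lam * s ^ 2) (β * s ^ 2) γ).gibbsMeasure (N + 1) (T / s ^ 2)) := by
  rw [integral_gibbsMeasure_smul hs.ne' (N + 1) T, ← integral_const_mul]
  refine integral_congr_ae (Eventually.of_forall fun z => ?_)
  simp only [Prod.smul_snd, Pi.smul_apply, smul_eq_mul]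
  rw [integral_snd_transitionKernel_smul hω hl hβ hγ hs (N + 1) T t.toNNReal z (Fin.last N)]
  ring

/-- **Unit-temperature form (`ScalingCovariance`)**: `r_N(t; lam, β, T) = T · r_N(t; lam T, β T, 1)`
for `T > 0`. [cite: AokiLukkarinenSpohn2006, §2 eqs. (2.8)-(2.13)] -/
theorem pairCorr_eq_temp_mul_unit (hω : 0 < ω₂) (hl : 0 ≤ lam) (hβ : 0 ≤ β) (hγ : 0 ≤ γ)
    {T : ℝ} (hT : 0 < T) (N : ℕ) (t : ℝ) :
    (∫ z, z.2 0 * (∫ y, y.2 (Fin.last N)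
      ∂((pinnedChain ω₂ lam β γ).transitionKernel (N + 1) T T t.toNNReal z))
      ∂((pinnedChain ω₂ lam β γ).gibbsMeasure (N + 1) T)) =
    T * ∫ z, z.2 0 * (∫ y, y.2 (Fin.last N)
      ∂((pinnedChain ω₂ (lam * T) (β * T) γ).transitionKernel (N + 1) 1 1 t.toNNReal z))
      ∂((pinnedChain ω₂ (lam * T) (β * T) γ).gibbsMeasure (N + 1) 1) := by
  have hs : 0 < Real.sqrt T := Real.sqrt_pos.2 hT
  have hs2 : Real.sqrt T ^ 2 = T := Real.sq_sqrt hT.le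
  have h := pairCorr_smul hω hl hβ hγ hs N T t
  rw [hs2, div_self hT.ne'] at h
  exact h


/-- Abstract rescaling of a slice of the crux: if `f_N = c · g_N` with `c ≠ 0`, integrability of
`f_N²` on `(0,∞)` and `N ∫ f_N² → 0` are equivalent to the same for `g`. [folklore] -/
theorem slice_iff_of_eq_const_mul {f g : ℕ → ℝ → ℝ} {c : ℝ} (hc : c ≠ 0)
    (hfg : ∀ N t, f N t = c * g N t) :
    ((∀ N : ℕ, IntegrableOn (fun t : ℝ => f N t ^ 2) (Ioi 0)) ∧
        Tendsto (fun N : ℕ => (N : ℝ) * ∫ t in Ioi (0 : ℝ), f N t ^ 2) atTop (𝓝 0)) ↔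
      ((∀ N : ℕ, IntegrableOn (fun t : ℝ => g N t ^ 2) (Ioi 0)) ∧
        Tendsto (fun N : ℕ => (N : ℝ) * ∫ t in Ioi (0 : ℝ), g N t ^ 2) atTop (𝓝 0)) := by
  have hc2 : c ^ 2 ≠ 0 := pow_ne_zero 2 hc
  have hf2 : ∀ N, (fun t : ℝ => f N t ^ 2) = fun t => c ^ 2 • (g N t ^ 2) := by
    intro N; funext t; rw [hfg, smul_eq_mul]; ring
  have hint : ∀ N, IntegrableOn (fun t : ℝ => f N t ^ 2) (Ioi 0) ↔
      IntegrableOn (fun t : ℝ => g N t ^ 2) (Ioi 0) := by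
    intro N
    rw [hf2]
    exact integrable_smul_iff hc2 _
  have hI : ∀ N : ℕ, (N : ℝ) * ∫ t in Ioi (0 : ℝ), f N t ^ 2 =
      c ^ 2 * ((N : ℝ) * ∫ t in Ioi (0 : ℝ), g N t ^ 2) := by
    intro N
    rw [hf2]
    rw [show (fun t : ℝ => c ^ 2 • g N t ^ 2) = fun t => c ^ 2 * g N t ^ 2 from rfl,
      integral_const_mul]
    ring
  simp_rw [hint, hI]
  refine and_congr_right fun _ => ⟨fun h => ?_, fun h => by simpa using h.const_mul (c ^ 2)⟩
  have h' := h.const_mul (c ^ 2)⁻¹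
  simp only [mul_zero] at h'
  refine h'.congr fun N => ?_
  rw [← mul_assoc, inv_mul_cancel₀ hc2, one_mul]

open Summit.AtomisticToContinuum.FouriersLaw.Theses.PhononMeanFreePath in
/-- **Normal form: the crux is its unit-temperature slice over all couplings.** The quantifier
`∀ T > 0` is redundant given `∀ lam, β > 0`: by the exact amplitude-scaling conjugacy of the
constructed kernels and Gibbs measures, `(lam, β, T) ≡ (lam T, β T, 1)` and
`N ∫ r_N² = T² · (N ∫ r_N²)|_{(lam T, β T, 1)}`. [folklore] -/
theorem coherentDephasing_iff_unit_temperature :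
    CoherentDephasing ↔ ∀ ω₂ lam β γ : ℝ, 0 < ω₂ → 0 < lam → 0 < β → 0 < γ →
      (∀ N : ℕ, IntegrableOn (fun t : ℝ => (∫ z, z.2 0 * (∫ y, y.2 (Fin.last N)
          ∂((pinnedChain ω₂ lam β γ).transitionKernel (N + 1) 1 1 t.toNNReal z))
          ∂((pinnedChain ω₂ lam β γ).gibbsMeasure (N + 1) 1)) ^ 2) (Ioi 0)) ∧
        Tendsto (fun N : ℕ => (N : ℝ) * ∫ t in Ioi (0 : ℝ), (∫ z, z.2 0 * (∫ y, y.2 (Fin.last N)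
          ∂((pinnedChain ω₂ lam β γ).transitionKernel (N + 1) 1 1 t.toNNReal z))
          ∂((pinnedChain ω₂ lam β γ).gibbsMeasure (N + 1) 1)) ^ 2) atTop (𝓝 0) := by
  refine ⟨fun h ω₂ lam β γ hω hl hβ hγ => h ω₂ lam β γ hω hl hβ hγ 1 one_pos, ?_⟩
  intro h ω₂ lam β γ hω hl hβ hγ T hT
  have key := slice_iff_of_eq_const_mul (c := T) hT.ne'
    (f := fun N t => ∫ z, z.2 0 * (∫ y, y.2 (Fin.last N)
          ∂((pinnedChain ω₂ lam β γ).transitionKernel (N + 1) T T t.toNNReal z))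
          ∂((pinnedChain ω₂ lam β γ).gibbsMeasure (N + 1) T))
    (g := fun N t => ∫ z, z.2 0 * (∫ y, y.2 (Fin.last N)
          ∂((pinnedChain ω₂ (lam * T) (β * T) γ).transitionKernel (N + 1) 1 1 t.toNNReal z))
          ∂((pinnedChain ω₂ (lam * T) (β * T) γ).gibbsMeasure (N + 1) 1))
    (fun N t => pairCorr_eq_temp_mul_unit hω hl.le hβ.le hγ.le hT N t)
  exact key.2 (h ω₂ (lam * T) (β * T) γ hω (by positivity) (by positivity) hγ)


/-! ## Corollaries of the normal form for the sibling items (added in rev 2) -/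

/-- Component form of the slice rescaling: integrability of `f_N²` iff of `g_N²` when `f_N = c g_N`,
`c ≠ 0`. [folklore] -/
theorem integrableOn_sq_iff_of_eq_const_mul {f g : ℝ → ℝ} {c : ℝ} (hc : c ≠ 0)
    (hfg : ∀ t, f t = c * g t) :
    IntegrableOn (fun t : ℝ => f t ^ 2) (Ioi 0) ↔ IntegrableOn (fun t : ℝ => g t ^ 2) (Ioi 0) := by
  have hf2 : (fun t : ℝ => f t ^ 2) = fun t => c ^ 2 • (g t ^ 2) := by
    funext t; rw [hfg, smul_eq_mul]; ring
  rw [hf2]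
  exact integrable_smul_iff (pow_ne_zero 2 hc) _

/-- Component form of the slice rescaling: `N ∫ f_N² → 0` iff `N ∫ g_N² → 0` when `f_N = c g_N`,
`c ≠ 0`. [folklore] -/
theorem tendsto_natMul_integral_sq_iff_of_eq_const_mul {f g : ℕ → ℝ → ℝ} {c : ℝ} (hc : c ≠ 0)
    (hfg : ∀ N t, f N t = c * g N t) :
    Tendsto (fun N : ℕ => (N : ℝ) * ∫ t in Ioi (0 : ℝ), f N t ^ 2) atTop (𝓝 0) ↔
      Tendsto (fun N : ℕ => (N : ℝ) * ∫ t in Ioi (0 : ℝ), g N t ^ 2) atTop (𝓝 0) := by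
  have hc2 : c ^ 2 ≠ 0 := pow_ne_zero 2 hc
  have hI : ∀ N : ℕ, (N : ℝ) * ∫ t in Ioi (0 : ℝ), f N t ^ 2 =
      c ^ 2 * ((N : ℝ) * ∫ t in Ioi (0 : ℝ), g N t ^ 2) := by
    intro N
    have hf2 : (fun t : ℝ => f N t ^ 2) = fun t => c ^ 2 * g N t ^ 2 := by
      funext t; rw [hfg]; ring
    rw [hf2, integral_const_mul]
    ring
  simp_rw [hI]
  refine ⟨fun h => ?_, fun h => by simpa using h.const_mul (c ^ 2)⟩
  have h' := h.const_mul (c ^ 2)⁻¹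
  simp only [mul_zero] at h'
  refine h'.congr fun N => ?_
  rw [← mul_assoc, inv_mul_cancel₀ hc2, one_mul]

open Summit.AtomisticToContinuum.FouriersLaw.Theses.PhononMeanFreePath in
/-- **The weak-coupling support item (stmt-11813) is the small-coupling CORNER of the normal form**:
it is equivalent to the unit-temperature slice on `{0 < a, b ≤ ε₀}` for some `ε₀(ω₂, γ) > 0`. So the
route's foreseen regime split of the crux is a split of the COUPLING quadrant at `T = 1` (corner +
complement), not of the temperature axis. [folklore] -/
theorem coherentDephasingWeakCoupling_iff_corner :
    CoherentDephasingWeakCoupling ↔ ∀ ω₂ γ : ℝ, 0 < ω₂ → 0 < γ → ∃ ε₀ : ℝ, 0 < ε₀ ∧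
      ∀ a b : ℝ, 0 < a → 0 < b → a ≤ ε₀ → b ≤ ε₀ →
        (∀ N : ℕ, IntegrableOn (fun t : ℝ => (∫ z, z.2 0 * (∫ y, y.2 (Fin.last N)
          ∂((pinnedChain ω₂ a b γ).transitionKernel (N + 1) 1 1 t.toNNReal z))
          ∂((pinnedChain ω₂ a b γ).gibbsMeasure (N + 1) 1)) ^ 2) (Ioi 0)) ∧
        Tendsto (fun N : ℕ => (N : ℝ) * ∫ t in Ioi (0 : ℝ), (∫ z, z.2 0 * (∫ y, y.2 (Fin.last N)
          ∂((pinnedChain ω₂ a b γ).transitionKernel (N + 1) 1 1 t.toNNReal z))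
          ∂((pinnedChain ω₂ a b γ).gibbsMeasure (N + 1) 1)) ^ 2) atTop (𝓝 0) := by
  constructor
  · intro h ω₂ γ hω hγ
    obtain ⟨ε₀, hε, hc⟩ := h ω₂ γ hω hγ
    refine ⟨ε₀, hε, fun a b ha hb hae hbe => ?_⟩
    exact hc a b 1 ha hb one_pos (by simpa using hae) (by simpa using hbe)
  · intro h ω₂ γ hω hγ
    obtain ⟨ε₀, hε, hc⟩ := h ω₂ γ hω hγ
    refine ⟨ε₀, hε, fun lam β T hl hβ hT hlT hβT => ?_⟩
    have key := slice_iff_of_eq_const_mul (c := T) hT.ne'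
      (f := fun N t => ∫ z, z.2 0 * (∫ y, y.2 (Fin.last N)
            ∂((pinnedChain ω₂ lam β γ).transitionKernel (N + 1) T T t.toNNReal z))
            ∂((pinnedChain ω₂ lam β γ).gibbsMeasure (N + 1) T))
      (g := fun N t => ∫ z, z.2 0 * (∫ y, y.2 (Fin.last N)
            ∂((pinnedChain ω₂ (lam * T) (β * T) γ).transitionKernel (N + 1) 1 1 t.toNNReal z))
            ∂((pinnedChain ω₂ (lam * T) (β * T) γ).gibbsMeasure (N + 1) 1))
      (fun N t => pairCorr_eq_temp_mul_unit hω hl.le hβ.le hγ.le hT N t)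
    exact key.2 (hc (lam * T) (β * T) (by positivity) (by positivity) hlT hβT)

open Summit.AtomisticToContinuum.FouriersLaw.Theses.PhononMeanFreePath in
/-- **The harmonic calibration item (stmt-11814) reduces to `T = 1`**: at `lam = β = 0` the scaling
fixes the couplings and only rescales the temperature, `r_N(t; 0, 0, T) = T · r_N(t; 0, 0, 1)`, so
`HarmonicCoherentPersistence` is equivalent to its unit-temperature instance. [folklore] -/
theorem harmonicCoherentPersistence_iff_unit :
    HarmonicCoherentPersistence ↔ ∀ ω₂ γ : ℝ, 0 < ω₂ → 0 < γ →
      (∀ N : ℕ, IntegrableOn (fun t : ℝ => (∫ z, z.2 0 * (∫ y, y.2 (Fin.last N)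
          ∂((pinnedChain ω₂ 0 0 γ).transitionKernel (N + 1) 1 1 t.toNNReal z))
          ∂((pinnedChain ω₂ 0 0 γ).gibbsMeasure (N + 1) 1)) ^ 2) (Ioi 0)) ∧
        ¬ Tendsto (fun N : ℕ => (N : ℝ) * ∫ t in Ioi (0 : ℝ), (∫ z, z.2 0 * (∫ y, y.2 (Fin.last N)
          ∂((pinnedChain ω₂ 0 0 γ).transitionKernel (N + 1) 1 1 t.toNNReal z))
          ∂((pinnedChain ω₂ 0 0 γ).gibbsMeasure (N + 1) 1)) ^ 2) atTop (𝓝 0) := by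
  have scale : ∀ {ω₂ γ T : ℝ}, 0 < ω₂ → 0 < γ → 0 < T → ∀ (N : ℕ) (t : ℝ),
      (∫ z, z.2 0 * (∫ y, y.2 (Fin.last N)
          ∂((pinnedChain ω₂ 0 0 γ).transitionKernel (N + 1) T T t.toNNReal z))
          ∂((pinnedChain ω₂ 0 0 γ).gibbsMeasure (N + 1) T)) =
        T * ∫ z, z.2 0 * (∫ y, y.2 (Fin.last N)
          ∂((pinnedChain ω₂ 0 0 γ).transitionKernel (N + 1) 1 1 t.toNNReal z))
          ∂((pinnedChain ω₂ 0 0 γ).gibbsMeasure (N + 1) 1) := by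
    intro ω₂ γ T hω hγ hT N t
    have h := pairCorr_eq_temp_mul_unit (lam := 0) (β := 0) hω le_rfl le_rfl hγ.le hT N t
    simpa using h
  constructor
  · intro h ω₂ γ hω hγ
    exact h ω₂ γ hω hγ 1 one_pos
  · intro h ω₂ γ hω hγ T hT
    obtain ⟨hint, hnot⟩ := h ω₂ γ hω hγ
    refine ⟨fun N => ?_, fun hlim => hnot ?_⟩
    · exact (integrableOn_sq_iff_of_eq_const_mul hT.ne' (fun t => scale hω hγ hT N t)).2 (hint N)
    · exact (tendsto_natMul_integral_sq_iff_of_eq_const_mul hT.ne'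
        (fun N t => scale hω hγ hT N t)).1 hlim

end Summit.AtomisticToContinuum.FouriersLaw.Theorems.CoherentDephasing.Negative.ScalingNormalForm
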